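import Summits.BirchSwinnertonDyer.Rank1Residual.X5.TwoAdicTargetsSplitGS
import Summits.BirchSwinnertonDyer.Rank1Residual.X5.TwoAdicTargetsMultAuto
import Summits.BirchSwinnertonDyer.Rank1Residual.X5.TwoAdicTargetsTam
import HarnessLib

/-!
# Class O1 (X5, `p = 2`, non-CM): the BSD-sharp upper half and the Jetchev shape
# `TamagawaRemovalAtTwo W 0` on the MULTIPLICATIVE-at-`2` branch, from the two memo-proved inputs

HONEST FRAMING (cell `bsd-2adic`, run/shared/lean/pub/bsd-2adic/, FULL-BSD rank ≤ 1 programme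
tranche 1b, D-0036; seat `bsd-2adic-mult`, GEN 2): research routes; no claim beyond the stated
classes; nothing here is booked; no mark of RESIDUAL-MAP §I moves. Theorems only: 0 typed targets,
0 named facts. The README names `TamagawaRemovalAtTwo` (`X5/TwoAdicTargetsTam.lean`: shape J — per
place `v`, `ord₂ #Ш + ord₂ c_v ≤ ord₂ #Ш_an + ord₂ ∏c_ℓ + δ` — the Tamagawa-lossy finite-level
Euler-system shape) among this seat's objects. On the multiplicative-at-`2` branch it is NOT an
independent obstacle: the `Λ`-adic road of `HOME/mult/PROOF-MULT.md` §6.2 delivers the BSD-SHARP upper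
half `MissingUpperBoundAt W 2` (Greenberg's displays A235/A236 carry the full `∏ c_ℓ`), which implies
shape J with `δ = 0` trivially (`ord₂ c_v ≤ ord₂ ∏ c_ℓ`). This file records that implication with
all research inputs reduced to the two memo-proved binders and a `μ = 0` source:

* `missingUpperBoundAt_two_mult_of_mu_eq_zero` (PROVED): `Mult W 2`, `r_an = 0` ⇒
  `MissingUpperBoundAt W 2` ⟸ PRINT {A235, A236, modularity, GZK} + K11a/K11b-Rat `hK` (PROOF-MULT) +
  `greenberg_stevens W 2` (PROOF-GS2; used on the split branch through `kappaOne_binder_of_greenbergStevens`)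
  + `hμ` (a `μ = 0` certificate) + `hper₀` — both signs dispatched (`by_cases` on split).
* `missingUpperBoundAt_two_mult_of_prop514` (PROVED): the same on the Prop. 5.14 locus (`h514` + the
  decidable 5.14 data in place of `hμ`).
* `tamagawaRemovalAtTwo_zero_of_mult_of_mu_eq_zero`, `tamagawaRemovalAtTwo_zero_of_mult_of_prop514`
  (PROVED): `TamagawaRemovalAtTwo W 0` at a multiplicative `2` from the same inputs (its internal
  binders `¬ CM`, `TwoAdicSurjective` are not even used). The good-ordinary-at-`2` disjunct of the
  target is seat `bsd-2adic-ord`'s (K4ᵒ-μ) and is untouched here.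

References: [Jetchev2008] Thm. 1.4 (shape only); [GreenbergLNM1716] §4 pp. 112–113, Prop. 5.14;
[Miller2011LMS] Def. 1.1; [MazurTateTeitelbaum1986Invent] §I.10, §I.12.
-/

set_option autoImplicit false

noncomputable section

open scoped Classical MatrixGroups ModularForm

open CongruenceSubgroup WeierstrassCurve NumberField IsDedekindDomain
  Literature.NumberTheory.EllipticCurves
  Literature.NumberTheory.EllipticCurves.ModularForms
  Literature.NumberTheory.EllipticCurves.Greenberg1999
  Literature.NumberTheory.EllipticCurves.Rank1Residual
  Literature.NumberTheory.EllipticCurves.Rank1Residual.Typed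

namespace Summit.BirchSwinnertonDyer.Rank1Residual.X5.O1

variable (W : WeierstrassCurve ℚ) [W.IsElliptic] [W.IsGloballyMinimal]

/-! ## §1 The BSD-sharp upper half at a multiplicative `2`, both signs -/

/-- **`MissingUpperBoundAt W 2` at a MULTIPLICATIVE `2` in analytic rank `0` from a `μ = 0`
certificate (PROVED; both signs).** Inputs: Greenberg's displays at `2` (A235 `h41n`, A236 `h41s`;
PRINT), modularity, GZK (PRINT); K11a `hKn` / K11b-Rat `hKs` (PROOF-MULT Thm. A/B);
`greenberg_stevens W 2` (`hGS`, PROOF-GS2 — used only if the reduction is split, to discharge the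
`κ₁`-certificate); `hμ`; `hper₀`. Non-split: `missingUpperBoundAt_two_nonsplit_of_mu_eq_zero_auto`;
split: `missingUpperBoundAt_two_split_of_mu_eq_zero_auto` with `hκ₁ := kappaOne_binder_of_greenbergStevens`.
[cite: GreenbergLNM1716, §4 pp. 112–113] [cite: Miller2011LMS, Def. 1.1] [cite: MazurTateTeitelbaum1986Invent, §I.12] -/
theorem missingUpperBoundAt_two_mult_of_mu_eq_zero
    (hGS : greenberg_stevens (W := W) (p := 2))
    (h41n : thm41Analogue_charValue_rankZero_numberField_anyPrime)
    (h41s : thm41Analogue_charValue_rankZero_split_baseChange_anyPrime)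
    (hmod : nonempty_modularParametrizationData)
    (hGZK : rank_eq_analyticRank_of_analyticRank_le_one)
    (hKn : ∀ [NeZero (W.conductorNorm ℤ)] (f : CuspForm (Gamma0 (W.conductorNorm ℤ)) 2)
      (L : PowerSeries ℚ_[2]), KatoDivisibilityAtTwoNonsplitMultRat W f L)
    (hKs : ∀ [NeZero (W.conductorNorm ℤ)] (f : CuspForm (Gamma0 (W.conductorNorm ℤ)) 2)
      (L : PowerSeries ℚ_[2]), KatoDivisibilityAtTwoSplitMultRat W f L)
    (hμ : ∀ (κ : ZpExtension ℚ 2) (γ : Field.absoluteGaloisGroup ℚ), κ.IsCyclotomic →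
      κ.IsTopGenerator γ → IsCyclotomicVariable 2 γ → ∀ D : W.SelmerDualData κ γ, D.mu = 0)
    (hper₀ : ∀ [NeZero (W.conductorNorm ℤ)] (f : CuspForm (Gamma0 (W.conductorNorm ℤ)) 2),
      IsNewformOf W f → ∀ ϖ : ℚ, (ϖ : ℝ) * W.realPeriodRat = plusPeriod f → 0 ≤ padicValRat 2 ϖ)
    (hr : W.analyticRank = 0) (hmult : Mult W 2) : MissingUpperBoundAt W 2 := by
  by_cases hsp : W.HasSplitMultiplicativeReductionAtPrime 2
  · exact missingUpperBoundAt_two_split_of_mu_eq_zero_auto W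
      (twoAdicEulerCharRankZeroSplitMult_zero_of_greenberg W h41s) hmod hGZK hKs hμ
      (kappaOne_binder_of_greenbergStevens W hGS hr) hper₀ hr hmult hsp
  · exact missingUpperBoundAt_two_nonsplit_of_mu_eq_zero_auto W
      (twoAdicEulerCharRankZeroNonsplitMult_zero_of_greenberg W h41n) hmod hGZK hKn hμ hper₀ hr hmult
      hsp

/-- **`MissingUpperBoundAt W 2` at a multiplicative `2`, analytic rank `0`, on the Prop. 5.14 locus
(PROVED; both signs):** as above with `hμ` supplied by Prop. 5.14 at `2` (`h514`, PRINT — Greenberg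
states 5.13/5.14 for "good, ordinary or multiplicative reduction at 2") and the decidable datum of a
rational `2`-torsion point that is ramified-at-`2` XOR odd.
[cite: GreenbergLNM1716, Prop. 5.14 (p. 121) and §4 pp. 112–113] [cite: Miller2011LMS, Def. 1.1] -/
theorem missingUpperBoundAt_two_mult_of_prop514
    (hGS : greenberg_stevens (W := W) (p := 2))
    (h514 : prop514_isTorsion_mu_eq_zero_two)
    (h41n : thm41Analogue_charValue_rankZero_numberField_anyPrime)
    (h41s : thm41Analogue_charValue_rankZero_split_baseChange_anyPrime)
    (hmod : nonempty_modularParametrizationData)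
    (hGZK : rank_eq_analyticRank_of_analyticRank_le_one)
    (hKn : ∀ [NeZero (W.conductorNorm ℤ)] (f : CuspForm (Gamma0 (W.conductorNorm ℤ)) 2)
      (L : PowerSeries ℚ_[2]), KatoDivisibilityAtTwoNonsplitMultRat W f L)
    (hKs : ∀ [NeZero (W.conductorNorm ℤ)] (f : CuspForm (Gamma0 (W.conductorNorm ℤ)) 2)
      (L : PowerSeries ℚ_[2]), KatoDivisibilityAtTwoSplitMultRat W f L)
    (hper₀ : ∀ [NeZero (W.conductorNorm ℤ)] (f : CuspForm (Gamma0 (W.conductorNorm ℤ)) 2),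
      IsNewformOf W f → ∀ ϖ : ℚ, (ϖ : ℝ) * W.realPeriodRat = plusPeriod f → 0 ≤ padicValRat 2 ϖ)
    (hr : W.analyticRank = 0) (hmult : Mult W 2)
    {x y : ℚ} (hP : W.toAffine.Equation x y) (h2 : 2 * y + W.a₁ * x + W.a₃ = 0)
    (hΦ : (TwoTorsionRamifiedAtTwo x ∧ ¬ TwoTorsionOdd W x) ∨
      (TwoTorsionOdd W x ∧ ¬ TwoTorsionRamifiedAtTwo x)) : MissingUpperBoundAt W 2 :=
  missingUpperBoundAt_two_mult_of_mu_eq_zero W hGS h41n h41s hmod hGZK hKn hKs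
    (fun _ _ hκ hγ _ D => (h514.of_mult W hmult hP h2 hΦ hκ hγ D).2) hper₀ hr hmult

/-! ## §2 The Jetchev shape `TamagawaRemovalAtTwo W 0` on the multiplicative branch -/

omit [W.IsGloballyMinimal] in
/-- **Shape W (sharp) ⇒ shape J**: `MissingUpperBoundAt W 2` gives, for every finite place `v`,
`ord₂ #Ш + ord₂ c_v ≤ ord₂ #Ш_an + ord₂ ∏ c_ℓ` (because `c_v ∣ ∏ c_ℓ`). Bookkeeping. [folklore] -/
theorem tamagawaShape_of_missingUpperBoundAt_two (h : MissingUpperBoundAt W 2) :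
    ∃ q : ℚ, shaAn W = q ∧ ∀ v : HeightOneSpectrum (𝓞 ℚ),
      (padicValNat 2 W.shaOrder : ℤ) + padicValNat 2 (W.tamagawaNumberAt v) ≤
        padicValRat 2 q + padicValNat 2 W.tamagawaProduct + (0 : ℕ) := by
  haveI : Fact (Nat.Prime 2) := ⟨Nat.prime_two⟩
  obtain ⟨q, hq, hle⟩ := h
  refine ⟨q, hq, fun v => ?_⟩
  have hv : (padicValNat 2 (W.tamagawaNumberAt v) : ℤ) ≤ padicValNat 2 W.tamagawaProduct := by
    exact_mod_cast padicValNat_tamagawaNumberAt_le W 2 v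
  rw [Nat.cast_zero, add_zero]
  linarith

/-- **`TamagawaRemovalAtTwo W 0` at a MULTIPLICATIVE `2` from a `μ = 0` certificate (PROVED).** The
target's own binders `¬ CM`, `TwoAdicSurjective W` are not used; `r_an = 0` is its internal
hypothesis; the disjunct `GoodOrd W 2` is excluded by `Mult W 2` being given. Inputs as in
`missingUpperBoundAt_two_mult_of_mu_eq_zero`. [cite: Jetchev2008, Thm. 1.4 (shape only)]
[cite: GreenbergLNM1716, §4 pp. 112–113] -/
theorem tamagawaRemovalAtTwo_zero_of_mult_of_mu_eq_zero
    (hGS : greenberg_stevens (W := W) (p := 2))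
    (h41n : thm41Analogue_charValue_rankZero_numberField_anyPrime)
    (h41s : thm41Analogue_charValue_rankZero_split_baseChange_anyPrime)
    (hmod : nonempty_modularParametrizationData)
    (hGZK : rank_eq_analyticRank_of_analyticRank_le_one)
    (hKn : ∀ [NeZero (W.conductorNorm ℤ)] (f : CuspForm (Gamma0 (W.conductorNorm ℤ)) 2)
      (L : PowerSeries ℚ_[2]), KatoDivisibilityAtTwoNonsplitMultRat W f L)
    (hKs : ∀ [NeZero (W.conductorNorm ℤ)] (f : CuspForm (Gamma0 (W.conductorNorm ℤ)) 2)
      (L : PowerSeries ℚ_[2]), KatoDivisibilityAtTwoSplitMultRat W f L)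
    (hμ : ∀ (κ : ZpExtension ℚ 2) (γ : Field.absoluteGaloisGroup ℚ), κ.IsCyclotomic →
      κ.IsTopGenerator γ → IsCyclotomicVariable 2 γ → ∀ D : W.SelmerDualData κ γ, D.mu = 0)
    (hper₀ : ∀ [NeZero (W.conductorNorm ℤ)] (f : CuspForm (Gamma0 (W.conductorNorm ℤ)) 2),
      IsNewformOf W f → ∀ ϖ : ℚ, (ϖ : ℝ) * W.realPeriodRat = plusPeriod f → 0 ≤ padicValRat 2 ϖ)
    (hmult : Mult W 2) : TamagawaRemovalAtTwo W 0 := by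
  intro _ hr _ _
  exact tamagawaShape_of_missingUpperBoundAt_two W
    (missingUpperBoundAt_two_mult_of_mu_eq_zero W hGS h41n h41s hmod hGZK hKn hKs hμ hper₀ hr hmult)

/-- **`TamagawaRemovalAtTwo W 0` at a multiplicative `2` on the Prop. 5.14 locus (PROVED).**
[cite: Jetchev2008, Thm. 1.4 (shape only)] [cite: GreenbergLNM1716, Prop. 5.14 (p. 121) and §4 pp. 112–113] -/
theorem tamagawaRemovalAtTwo_zero_of_mult_of_prop514
    (hGS : greenberg_stevens (W := W) (p := 2))
    (h514 : prop514_isTorsion_mu_eq_zero_two)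
    (h41n : thm41Analogue_charValue_rankZero_numberField_anyPrime)
    (h41s : thm41Analogue_charValue_rankZero_split_baseChange_anyPrime)
    (hmod : nonempty_modularParametrizationData)
    (hGZK : rank_eq_analyticRank_of_analyticRank_le_one)
    (hKn : ∀ [NeZero (W.conductorNorm ℤ)] (f : CuspForm (Gamma0 (W.conductorNorm ℤ)) 2)
      (L : PowerSeries ℚ_[2]), KatoDivisibilityAtTwoNonsplitMultRat W f L)
    (hKs : ∀ [NeZero (W.conductorNorm ℤ)] (f : CuspForm (Gamma0 (W.conductorNorm ℤ)) 2)
      (L : PowerSeries ℚ_[2]), KatoDivisibilityAtTwoSplitMultRat W f L)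
    (hper₀ : ∀ [NeZero (W.conductorNorm ℤ)] (f : CuspForm (Gamma0 (W.conductorNorm ℤ)) 2),
      IsNewformOf W f → ∀ ϖ : ℚ, (ϖ : ℝ) * W.realPeriodRat = plusPeriod f → 0 ≤ padicValRat 2 ϖ)
    (hmult : Mult W 2)
    {x y : ℚ} (hP : W.toAffine.Equation x y) (h2 : 2 * y + W.a₁ * x + W.a₃ = 0)
    (hΦ : (TwoTorsionRamifiedAtTwo x ∧ ¬ TwoTorsionOdd W x) ∨
      (TwoTorsionOdd W x ∧ ¬ TwoTorsionRamifiedAtTwo x)) : TamagawaRemovalAtTwo W 0 := by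
  intro _ hr _ _
  exact tamagawaShape_of_missingUpperBoundAt_two W
    (missingUpperBoundAt_two_mult_of_prop514 W hGS h514 h41n h41s hmod hGZK hKn hKs hper₀ hr hmult
      hP h2 hΦ)

end Summit.BirchSwinnertonDyer.Rank1Residual.X5.O1

end
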